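import Literature.Probability.RandomPlanarGeometry.SLESwallowingNearZero
import Literature.Probability.RandomPlanarGeometry.LoewnerArcSwallowing
import HarnessLib

/-!
# The SLE_κ trace is a.s. not injective for `4 < κ < 8` (Rohde–Schramm §1, proved)

Topic `Probability/RandomPlanarGeometry`; theorems only. We **discharge the named fact**
`Literature.Probability.RandomPlanarGeometry.ae_not_injective_sleTrace` (`CritPercSLE.lean`;
S. Rohde, O. Schramm, *Basic properties of SLE*, Ann. Math. 161 (2005), §1 p. 885: "For
`κ ∈ (4, 8)` the path `γ` is not a simple path"; O. Schramm (2000) for "a.s. `K_t` is not a simple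
path, `κ > 4`"): for `4 < κ < 8`, almost surely the SLE_κ trace `sleTrace κ ω` is not injective
(`ae_not_injective_sleTrace_holds`; in fact for all `κ > 4`, `ae_not_injective_sleTrace_of_four_lt`).

Proof (conformal Markov picture without a trace for the shifted chain, cf. the proof of
Rohde–Schramm's Thm 6.1 in `CritPercSLESimplePath.lean`):

1. *Probabilistic input.* For every `s`, the recentred shifted driving function
   `ξˢ = ξ(s + ·) - ξ(s)` has the law of `ξ = √κ B` (`identDistrib_sleDriving_shift`), so the
   a.s. statement "for every `m` some point `1/(n+1)` is swallowed by time `1/(m+1)`"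
   (`ae_forall_exists_swallowingTime_le`, `SLESwallowingNearZero.lean`, `κ > 4`) transfers to all
   the shifted chains at rational times simultaneously (`ae_forall_shift_exists_swallowingTime_le`,
   through the measurable path-space event `nearZeroSwallowEvent` read with
   `Literature.Probability.Process.pathRegularize`).
2. *Deterministic input.* On a path whose chain is generated by an **injective** curve `γ`, pick a
   rational time `s ∈ (0, 1)` with `γ s ∈ ℍ` (`IsGeneratedByCurve.exists_rat_mem_domain`, strict
   growth of hulls) and `ε > 0` with `γ[s, s + ε] ⊂ ℍ`; then every real point `x ≠ ξ(s)` has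
   swallowing time `> ε` for the chain of `ξ(s + ·)`
   (`IsGeneratedByCurve.lt_swallowingTime_shift`, `LoewnerArcSwallowing.lean`: the excursion
   `γ[s, s + ε]` is a simple arc in `Hₛ`, which swallows nothing, by Janiszewski's theorem).
   Un-recentring (`swallowingTime_add_const`) contradicts 1.
3. On a path whose chain is not generated by a curve, `sleTrace` is the junk constant path, which
   is not injective.

## References

* S. Rohde, O. Schramm, *Basic properties of SLE*, Ann. of Math. 161 (2005): §1 (p. 885),
  Prop. 2.1, §6 (Thm 6.1 and its proof, p. 902; Thm 6.4).
* O. Schramm, *Scaling limits of loop-erased random walks and uniform spanning trees*, Israel J.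
  Math. 118 (2000), §1 (for `κ > 4` the hull is not a simple path).
* G. F. Lawler, *Conformally Invariant Processes in the Plane* (2005), §4.4, §6.2.
-/

noncomputable section

open Set Filter MeasureTheory ProbabilityTheory Complex Metric
open _root_.Topology
open UpperHalfPlane (upperHalfPlaneSet)
open scoped NNReal

namespace Literature.Probability.RandomPlanarGeometry

open Loewner

variable {κ : ℝ≥0}

/-! ### The path-space event "small points are swallowed quickly" and its Markov transfer -/

/-- The path-space event **"for every `m` some point `1/(n+1)` is swallowed by time `1/(m+1)`"**
(read through `regPath`). [folklore] -/
def nearZeroSwallowEvent : Set (ℝ≥0 → ℝ) :=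
  ⋂ m : ℕ, ⋃ n : ℕ, swallowLeEvent ((1 : ℝ) / ((n : ℝ) + 1)) (1 / ((m : ℝ≥0) + 1))

/-- The event is measurable. [folklore] -/
theorem measurableSet_nearZeroSwallowEvent : MeasurableSet nearZeroSwallowEvent :=
  MeasurableSet.iInter fun _ ↦ MeasurableSet.iUnion fun _ ↦
    measurableSet_swallowLeEvent (by positivity) _

/-- For a continuous path from `0`, membership in the event is the target property. [folklore] -/
theorem mem_nearZeroSwallowEvent_iff {w : ℝ≥0 → ℝ} (hw : Continuous w) (hw0 : w 0 = 0) :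
    w ∈ nearZeroSwallowEvent ↔ ∀ m : ℕ, ∃ n : ℕ,
      swallowingTime w (((1 : ℝ) / ((n : ℝ) + 1) : ℝ) : ℂ) ≤ ((1 / ((m : ℝ≥0) + 1) : ℝ≥0) : WithTop ℝ≥0) := by
  simp only [nearZeroSwallowEvent, mem_iInter, mem_iUnion, mem_swallowLeEvent_iff hw hw0]

/-- **Markov transfer**: for `κ > 4` and every `s`, almost surely the recentred shifted driving
function `u ↦ ξ(s + u) - ξ(s)` swallows, for every `m`, some point `1/(n+1)` by time `1/(m+1)`
(`ae_forall_exists_swallowingTime_le` transported along `identDistrib_sleDriving_shift`).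
[cite: RohdeSchramm2005, Prop. 2.1] -/
theorem ae_shift_mem_nearZeroSwallowEvent (hκ : 4 < κ) (s : ℝ≥0) :
    ∀ᵐ ω ∂Process.preWienerMeasure,
      (fun u ↦ sleDriving κ ω (s + u) - sleDriving κ ω s) ∈ nearZeroSwallowEvent := by
  have h1 : ∀ᵐ ω ∂Process.preWienerMeasure, (fun t ↦ sleDriving κ ω t) ∈ nearZeroSwallowEvent := by
    filter_upwards [ae_forall_exists_swallowingTime_le hκ] with ω hω
    exact (mem_nearZeroSwallowEvent_iff (continuous_sleDriving κ ω) (sleDriving_zero κ ω)).2 hω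
  have hid := identDistrib_sleDriving_shift κ s
  have hP1 : Process.preWienerMeasure ((fun ω t ↦ sleDriving κ ω t) ⁻¹' nearZeroSwallowEventᶜ) = 0 :=
    ae_iff.1 h1
  have hP2 : Process.preWienerMeasure
      ((fun ω u ↦ sleDriving κ ω (s + u) - sleDriving κ ω s) ⁻¹' nearZeroSwallowEventᶜ) = 0 := by
    rw [← hid.measure_mem_eq measurableSet_nearZeroSwallowEvent.compl]
    exact hP1
  exact ae_iff.2 hP2

/-- **All rational shifts at once**: for `κ > 4`, almost surely, for every non-negative rational
`q` and every `m` there is `n` with `T_{1/(n+1)} ≤ 1/(m+1)` for the chain of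
`u ↦ ξ(q + u) - ξ(q)`. [cite: RohdeSchramm2005, Prop. 2.1] -/
theorem ae_forall_shift_exists_swallowingTime_le (hκ : 4 < κ) :
    ∀ᵐ ω ∂Process.preWienerMeasure, ∀ q : ℚ, ∀ m : ℕ, ∃ n : ℕ,
      swallowingTime (fun u ↦ sleDriving κ ω ((q : ℝ).toNNReal + u) - sleDriving κ ω (q : ℝ).toNNReal)
        (((1 : ℝ) / ((n : ℝ) + 1) : ℝ) : ℂ) ≤ ((1 / ((m : ℝ≥0) + 1) : ℝ≥0) : WithTop ℝ≥0) := by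
  refine ae_all_iff.2 fun q ↦ ?_
  filter_upwards [ae_shift_mem_nearZeroSwallowEvent hκ (q : ℝ).toNNReal] with ω hω
  exact (mem_nearZeroSwallowEvent_iff (continuous_sleDriving_shift κ ω _) (by simp)).1 hω

/-! ### Assembly -/

/-- A constant path on `ℝ≥0` is not injective. [folklore] -/
theorem not_injective_const (c : ℂ) : ¬ Function.Injective (fun _ : ℝ≥0 ↦ c) := fun h ↦
  absurd (h (rfl : (fun _ : ℝ≥0 ↦ c) 0 = (fun _ : ℝ≥0 ↦ c) 1)) zero_ne_one

/-- **The deterministic contradiction.** Let the chain of the continuous `W` be generated by an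
injective `γ`, let `s` be a time with `γ s ∈ ℍ`, and suppose that for every `m` the chain of
`u ↦ W(s + u) - W(s)` swallows some point `1/(n+1)` by time `1/(m+1)`. This is impossible: for
`ε = 1/(m+1)` small enough that `γ[s, s + ε] ⊂ ℍ`, all real points `≠ W s` have swallowing time
`> ε` for `W(s + ·)` (`IsGeneratedByCurve.lt_swallowingTime_shift`), and un-recentring
(`swallowingTime_add_const`) gives the same for the points `1/(n+1)` of the recentred chain.
[cite: RohdeSchramm2005, §1 p. 885] -/
theorem Loewner.IsGeneratedByCurve.false_of_injective_of_swallow {W : ℝ≥0 → ℝ} {γ : ℝ≥0 → ℂ}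
    (hW : Continuous W) (hγ : IsGeneratedByCurve W γ) (hinj : Function.Injective γ) {s : ℝ≥0}
    (hs : 0 < (γ s).im)
    (hsw : ∀ m : ℕ, ∃ n : ℕ, swallowingTime (fun u ↦ W (s + u) - W s)
      (((1 : ℝ) / ((n : ℝ) + 1) : ℝ) : ℂ) ≤ ((1 / ((m : ℝ≥0) + 1) : ℝ≥0) : WithTop ℝ≥0)) : False := by
  -- `ε > 0` with `γ[s, s + ε] ⊂ ℍ`
  have hcont : ContinuousAt (fun r ↦ (γ r).im) s := (continuous_im.comp hγ.continuous).continuousAt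
  have hev : ∀ᶠ r in 𝓝 s, 0 < (γ r).im := hcont.eventually (Ioi_mem_nhds hs) |>.mono fun r h ↦ h
  obtain ⟨δ, hδ, hball⟩ := Metric.eventually_nhds_iff.1 hev
  obtain ⟨m, hm⟩ := exists_nat_one_div_lt hδ
  set ε : ℝ≥0 := 1 / ((m : ℝ≥0) + 1) with hε
  have hεpos : 0 < ε := by rw [hε]; positivity
  have hεδ : (ε : ℝ) < δ := by rw [hε]; push_cast; exact hm
  have him : ∀ r, s ≤ r → r ≤ s + ε → 0 < (γ r).im := by
    intro r hsr hrε
    refine hball ?_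
    rw [NNReal.dist_eq, abs_sub_lt_iff]
    have h1 : (s : ℝ) ≤ r := by exact_mod_cast hsr
    have h2 : (r : ℝ) ≤ s + ε := by exact_mod_cast hrε
    constructor <;> linarith
  -- deterministic: real points `≠ W s` flow beyond `ε` in the shifted chain
  have hlt : ∀ x : ℝ, x ≠ W s → (ε : WithTop ℝ≥0) < swallowingTime (fun u ↦ W (s + u)) x :=
    fun x hx ↦ hγ.lt_swallowingTime_shift hW (hinj.injOn) him hx
  -- probabilistic hypothesis at level `m`: some `1/(n+1)` is swallowed by `ε` (recentred chain)
  obtain ⟨n, hn⟩ := hsw m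
  set x : ℝ := (1 : ℝ) / ((n : ℝ) + 1) with hx
  have hxpos : 0 < x := by rw [hx]; positivity
  -- un-recentre: `T_{W s + x}[W(s+·)] = T_x[W(s+·) - W s]`
  have hshift : swallowingTime (fun u ↦ W (s + u)) ((W s + x : ℝ) : ℂ) =
      swallowingTime (fun u ↦ W (s + u) - W s) (x : ℂ) := by
    have h := swallowingTime_add_const (fun u ↦ W (s + u) - W s) (x : ℂ) (W s)
    simp only [sub_add_cancel] at h
    rw [← h]
    congr 1
    push_cast
    ring
  have h1 := hlt (W s + x) (fun h ↦ by linarith)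
  rw [hshift] at h1
  have hn' : swallowingTime (fun u ↦ W (s + u) - W s) (x : ℂ) ≤ (ε : WithTop ℝ≥0) := hn
  exact absurd hn' (not_le.2 h1)

/-- **The SLE_κ trace is a.s. not injective for every `κ > 4`.** On a.e. path: if the chain is not
generated by a curve, the trace is the junk constant path; otherwise an injective trace would
contradict `IsGeneratedByCurve.false_of_injective_of_swallow` at a rational time `s ∈ (0, 1)` with
`γ s ∈ ℍ` (`IsGeneratedByCurve.exists_rat_mem_domain`; `H₀ = ℍ`), using the a.s. swallowing of
small points by all rationally shifted chains (`ae_forall_shift_exists_swallowingTime_le`).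
[cite: RohdeSchramm2005, §1 p. 885] -/
theorem ae_not_injective_sleTrace_of_four_lt (hκ : 4 < κ) :
    ∀ᵐ ω ∂Process.preWienerMeasure, ¬ Function.Injective (sleTrace κ ω) := by
  filter_upwards [ae_forall_shift_exists_swallowingTime_le hκ] with ω hω
  by_cases hgen : ∃ γ, IsGeneratedByCurve (sleDriving κ ω) γ
  · intro hinj
    have hW := continuous_sleDriving κ ω
    have hγ : IsGeneratedByCurve (sleDriving κ ω) (sleTrace κ ω) := isGeneratedByCurve_trace hgen
    -- a rational time `s ∈ (0, 1)` with `γ s ∈ H₀ = ℍ`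
    obtain ⟨q, hq0, -, hqdom⟩ := hγ.exists_rat_mem_domain hW (zero_lt_one' ℝ≥0)
    have hs : 0 < (sleTrace κ ω ((q : ℝ).toNNReal)).im := domain_subset _ 0 hqdom
    exact hγ.false_of_injective_of_swallow hW hinj hs (hω q)
  · rw [sleTrace, Loewner.trace, dif_neg hgen]
    exact not_injective_const _

/-- **Rohde–Schramm (2005), §1 (proved)**: discharge of the named fact `ae_not_injective_sleTrace`
— for `4 < κ < 8`, almost surely the SLE_κ trace is not injective ("For `κ ∈ (4, 8)` the path `γ`
is not a simple path", p. 885). [cite: RohdeSchramm2005, §1 p. 885] -/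
theorem ae_not_injective_sleTrace_holds : ae_not_injective_sleTrace :=
  fun hκ _ ↦ ae_not_injective_sleTrace_of_four_lt hκ

end Literature.Probability.RandomPlanarGeometry
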